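import Literature.NumberTheory.EllipticCurves.KubertTateFiveMuDescentSqrtNegTwoMatrix
import Literature.NumberTheory.EllipticCurves.KubertTate172SqrtNegTwoValuations
import Literature.NumberTheory.EllipticCurves.KubertTate172ShaFive
import Literature.NumberTheory.EllipticCurves.KubertTateFiveGaussianTwistRankZero
import Mathlib.Tactic.NormNum.Prime
import HarnessLib

/-!
# The `5`-descent of `E_{17/2}` over `ℚ(√−2)`: `rank E(K) = 2`, `Ш(E ⊗ K)[5^∞] = 0` — so the twist `E_{17/2}^{(−8)}/ℚ` has RANK `1` and
# `t₅ = 0`: a rank-ONE door WITHOUT rational `5`-torsion at a NON-anomalous prime, inside the range of the printed Eisenstein `5`-converse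

PROOF-ONLY file (theorems only, no definition, no named fact, no `sorry`), topic `NumberTheory/EllipticCurves`; third instance of the matrix
form of the `5`-descent of the Kubert–Tate family over `ℚ(√−2)` (tree `KubertTateFiveMuDescentSqrtNegTwoMatrix`), at `(m, n) = (17, 2)`, over
ANY number field `K` with `[K : ℚ] = 2`, `θ² = −2` (`SqrtNegTwo.FieldData θ`):

  `E = E_{17/2} = [−15, −34, −68, 0, 0]`, `Δ = −2⁵·17⁵·89`, `rank E(ℚ) = 1`, `t₅(E) = 0` (tree `KubertTate172ShaFive`); `mn = 2·17` with `17` SPLIT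
  (`(3 + 2θ)(3 − 2θ)`) and `2 = −θ²`; `ℚ(√−2)`-tame (`89 ≡ 4 (mod 5)` splits: `89 ∥ 40² + 2`).

Over `K` the box has THREE places `(θ), (3 + 2θ), (3 − 2θ)` and is filled by the two `ℚ`-points `−T = (0, 68)`, `P₁ = (3910, 274550)` and ONE
`K`-point `R₁ = (−153/4, (−2023 + 1156θ)/8)` (from the rational point `u = −153/4` of the twist `−2Y² = g(u)`): the `3 × 3` matrix of
`log`-valuations of `f_T = xy − 2x² + 4y` relative to `f_T(2T) = 19652`, `M = [[1,2,2],[0,4,4],[4,1,0]]` (mod `5`), has left inverse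
`[[1,2,0],[1,2,1],[4,2,4]]`.

* `shaCorank_five_eq_zero` — **`t₅(E_{17/2} ⊗ K) = 0`**; `sha_torsionBy_five_eq_bot`; `mordellWeilRank_eq_two` — **`rank E_{17/2}(K) = 2`**; sequel
  `KubertTate172SqrtNegTwoTwist`: `rank E_{17/2}^{(−8)}(ℚ) = 1`, `t₅ = 0`, globally minimal model `[0, −178, 0, 32640, −591872]`, `a₅ = −1`:
  the hypotheses of Castella–Grossi–Lee–Skinner's Theorem E (`r = 1`) — T DISCHARGEABLE there modulo CGLS + GZK (Summits reading).
  Nothing here proves T or BSD.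

## References

* [SilvermanAEC2009] J. H. Silverman, *AEC*, 2nd ed., Thm. X.4.2, Prop. X.4.9, Exercise 10.1(c), Exercise 10.16, VII.3.1(b).
* [Fisher2001FiveSevenDescent] T. Fisher, JEMS 3 (2001), §§1–2.
* [IrelandRosen1990] K. Ireland, M. Rosen, *A Classical Introduction to Modern Number Theory*, 2nd ed., Ch. 13 §1.
-/
noncomputable section

open scoped Classical NNReal NumberField AddSubgroup
open WeierstrassCurve WeierstrassCurve.Isogeny Field IsDedekindDomain Ideal
open Literature.NumberTheory.EllipticCurves Literature.NumberTheory.EllipticCurves.KubertTateVelu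
  Literature.NumberTheory.EllipticCurves.KubertTateMuDescentNF Literature.NumberTheory.NumberFields
  Literature.NumberTheory.QuadraticFields

namespace Literature.NumberTheory.EllipticCurves

namespace KubertTate172SqrtNegTwoDescent

variable {K : Type} [Field K] [NumberField K] {θ : K}

/-! ## §1 The curve: `ℚ(√−2)`-tameness, the points over `K` -/

/-- **`ℚ(√−2)`-TAME**: every bad prime `ℓ ∈ {2, 17, 89}` has `ℓ ≢ 1 (mod 5)`, and `89 ≡ 4 (mod 5)` splits in `ℤ[√−2]`: `89 ∥ 40² + 2 = 18·89`.
[cite: Fisher2001FiveSevenDescent, §2] [cite: IrelandRosen1990, Ch. 13 §1] -/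
theorem sqrtNegTwo_tame : ∀ p : ℕ, p.Prime → (p : ℤ) ∣ (kubertTateFive (17 : ℤ) 2).Δ →
    p % 5 ≠ 1 ∧ (p % 5 = 4 → ∃ x : ℤ, (p : ℤ) ∣ x ^ 2 + 2 ∧ ¬ (p : ℤ) ^ 2 ∣ x ^ 2 + 2) := by
  intro p hp hdvd
  refine ⟨KubertTate172Descent.tame p hp hdvd, fun h4 ↦ ?_⟩
  rw [KubertTate172Descent.Δ_int] at hdvd
  have hdvdN : p ∣ 2 ^ 5 * 17 ^ 5 * 89 := by
    have h' : (p : ℤ) ∣ ((2 ^ 5 * 17 ^ 5 * 89 : ℕ) : ℤ) := by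
      have e : ((2 ^ 5 * 17 ^ 5 * 89 : ℕ) : ℤ) = 4043752736 := by norm_num
      rw [e]; exact (Int.dvd_neg.mpr hdvd)
    exact Int.natCast_dvd_natCast.mp h'
  have hpi := Nat.Prime.prime hp
  rcases hpi.dvd_or_dvd hdvdN with h | h
  · rcases hpi.dvd_or_dvd h with h | h
    · have := (Nat.prime_dvd_prime_iff_eq hp Nat.prime_two).mp (hpi.dvd_of_dvd_pow h); omega
    · have := (Nat.prime_dvd_prime_iff_eq hp (by norm_num : Nat.Prime 17)).mp (hpi.dvd_of_dvd_pow h); omega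
  · have := (Nat.prime_dvd_prime_iff_eq hp (by norm_num : Nat.Prime 89)).mp h
    subst this
    exact ⟨40, by norm_num, by norm_num⟩

/-- `E_{17/2} ⊗ K` is elliptic. [cite: Kubert1976, Table 3 (N = 5)] -/
theorem isElliptic : (kubertTateFive ((17 : ℤ) : K) ((2 : ℤ) : K)).IsElliptic :=
  haveI := KubertTate172Descent.isElliptic
  KubertTateGaussianTwist.isElliptic_base (K := K) 17 2

/-- The two `ℚ`-points `−T = (0, 68)`, `P₁ = (3910, 274550)`, the `K`-point `R₁ = (−153/4, (−2023 + 1156θ)/8)` and the base point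
`2T = (34, 578)` lie on `E_{17/2} ⊗ K` (`θ² = −2`). [cite: Fisher2001FiveSevenDescent, §2 (the family; these points verified in-file)] -/
theorem nonsingular_points (hK : SqrtNegTwo.FieldData θ) :
    (kubertTateFive ((17 : ℤ) : K) ((2 : ℤ) : K)).toAffine.Nonsingular 0 68 ∧
    (kubertTateFive ((17 : ℤ) : K) ((2 : ℤ) : K)).toAffine.Nonsingular 3910 274550 ∧
    (kubertTateFive ((17 : ℤ) : K) ((2 : ℤ) : K)).toAffine.Nonsingular (-153/4 : K) (((-2023 : K) + 1156 * θ) / 8) ∧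
    (kubertTateFive ((17 : ℤ) : K) ((2 : ℤ) : K)).toAffine.Nonsingular 34 578 := by
  haveI := isElliptic (K := K)
  have hsq := hK.sq_eq
  refine ⟨?_, ?_, ?_, ?_⟩ <;>
    rw [← Affine.equation_iff_nonsingular, KubertTateMuDescentNF.equation_iff_base (K := K) 17 2] <;> push_cast
  · norm_num
  · norm_num
  · linear_combination ((1156 : K) ^ 2 / 64) * hsq
  · norm_num

/-! ## §2 Distinctness of places -/

omit [NumberField K] in
/-- Places above different rational primes are different. [cite: IrelandRosen1990, Ch. 13 §1] -/
private theorem ne_of_natCast_mem {v w : HeightOneSpectrum (𝓞 K)} {ℓ ℓ' : ℕ} (hℓ : ℓ.Prime) (hℓ' : ℓ'.Prime)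
    (hne : ℓ ≠ ℓ') (h : (ℓ : 𝓞 K) ∈ v.asIdeal) (h' : (ℓ' : 𝓞 K) ∈ w.asIdeal) : v ≠ w := by
  rintro rfl
  have hd := natCast_dvd_of_intCast_mem hℓ h (d := ℓ') (by rw [Int.cast_natCast]; exact h')
  exact hne ((Nat.prime_dvd_prime_iff_eq hℓ hℓ').mp (Int.natCast_dvd_natCast.mp hd))

/-- Conjugate places above a split prime are different (`π + π̄ = s ∈ ℤ`, `ℓ ∈ v`, `a s + b ℓ = 1`). [cite: IrelandRosen1990, Ch. 13 §1] -/
private theorem ne_of_sum_mem (hK : SqrtNegTwo.FieldData θ) {v w : HeightOneSpectrum (𝓞 K)} {z z' : ℤ√(-2)} {s a b : ℤ} {ℓ : ℕ}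
    (hzz : z + z' = (s : ℤ√(-2))) (hab : a * s + b * ℓ = 1)
    (hv : v.asIdeal = span {hK.ringEquiv z}) (hw : w.asIdeal = span {hK.ringEquiv z'}) (hℓ : (ℓ : 𝓞 K) ∈ v.asIdeal) : v ≠ w := by
  rintro rfl
  have hz : hK.ringEquiv z ∈ v.asIdeal := by rw [hv]; exact mem_span_singleton_self _
  have hz' : hK.ringEquiv z' ∈ v.asIdeal := by rw [hw]; exact mem_span_singleton_self _
  have hs : (s : 𝓞 K) ∈ v.asIdeal := by
    rw [← hK.ringEquiv_intCast, ← hzz, map_add]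
    exact v.asIdeal.add_mem hz hz'
  apply v.isPrime.ne_top
  rw [Ideal.eq_top_iff_one]
  have e : (1 : 𝓞 K) = (a : 𝓞 K) * s + (b : 𝓞 K) * ℓ := by exact_mod_cast congrArg (fun t : ℤ ↦ (t : 𝓞 K)) hab.symm
  rw [e]
  exact v.asIdeal.add_mem (v.asIdeal.mul_mem_left _ hs) (v.asIdeal.mul_mem_left _ hℓ)

/-! ## §3 The descent over `K = ℚ(√−2)`: box full at three places -/

/-- **The complete `5`-descent of `E_{17/2}` over `K = ℚ(√−2)`**: `t₅(E ⊗ K) = 0`, `Ш(E ⊗ K)[5] = 0` and `rank E(K) + 1 = 3`.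
[cite: SilvermanAEC2009, Thm. X.4.2(a) and Thm. X.1.1] [cite: Fisher2001FiveSevenDescent, §2] -/
theorem descent (hK : SqrtNegTwo.FieldData θ) :
    haveI := isElliptic (K := K)
    (kubertTateFive ((17 : ℤ) : K) ((2 : ℤ) : K)).shaCorank 5 = 0 ∧
      (kubertTateFive ((17 : ℤ) : K) ((2 : ℤ) : K)).sha[((5 : ℕ) : ℤ)] = ⊥ ∧
      (kubertTateFive ((17 : ℤ) : K) ((2 : ℤ) : K)).mordellWeilRank + 1 = 3 := by
  haveI := isElliptic (K := K)
  haveI := KubertTate172Descent.isElliptic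
  haveI : Fact (Nat.Prime 3) := ⟨Nat.prime_three⟩
  obtain ⟨v₀, v₁, v₂, hv₀, hv₁, hv₂⟩ := exists_places hK
  obtain ⟨hℓ₀, hℓ₁, hℓ₂⟩ := natCast_mem_places hK hv₀ hv₁ hv₂
  obtain ⟨p₀, p₁, p₂⟩ := prime_gens hK
  have hπ₀ : hK.ringEquiv ⟨0, 1⟩ ∈ v₀.asIdeal := by rw [hv₀]; exact mem_span_singleton_self _
  have hπ₁ : hK.ringEquiv ⟨3, 2⟩ ∈ v₁.asIdeal := by rw [hv₁]; exact mem_span_singleton_self _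
  have hπ₂ : hK.ringEquiv ⟨3, -2⟩ ∈ v₂.asIdeal := by rw [hv₂]; exact mem_span_singleton_self _
  have h01 : v₀ ≠ v₁ := ne_of_natCast_mem Nat.prime_two (by norm_num) (by norm_num) hℓ₀ hℓ₁
  have h02 : v₀ ≠ v₂ := ne_of_natCast_mem Nat.prime_two (by norm_num) (by norm_num) hℓ₀ hℓ₂
  have h12 : v₁ ≠ v₂ := ne_of_sum_mem hK (z := ⟨3, 2⟩) (z' := ⟨3, -2⟩) (s := 6) (a := 3) (b := -1) (ℓ := 17)
    (by decide) (by norm_num) hv₁ hv₂ hℓ₁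
  have hpl : Function.Injective ![v₀, v₁, v₂] := by
    intro i j h
    fin_cases i <;> fin_cases j
    · rfl
    · exact absurd h h01
    · exact absurd h h02
    · exact absurd h h01.symm
    · rfl
    · exact absurd h h12
    · exact absurd h h02.symm
    · exact absurd h h12.symm
    · rfl
  -- the support: off the three places, `17 = (3 + 2θ)(3 − 2θ)` and `2 = θ·(−θ)` are units
  have hS : ∀ v : HeightOneSpectrum (𝓞 K), (∀ j, ![v₀, v₁, v₂] j ≠ v) →
      (((17 : ℤ) : ℤ) : 𝓞 K) ∉ v.asIdeal ∧ (((2 : ℤ) : ℤ) : 𝓞 K) ∉ v.asIdeal := by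
    intro v hv
    have n0 : v₀ ≠ v := hv 0
    have n1 : v₁ ≠ v := hv 1
    have n2 : v₂ ≠ v := hv 2
    have hP := v.isPrime
    constructor
    · intro h17mem
      have e : (((17 : ℤ) : ℤ) : 𝓞 K) = hK.ringEquiv ⟨3, 2⟩ * hK.ringEquiv ⟨3, -2⟩ := by
        rw [← map_mul, ← hK.ringEquiv_intCast]; exact congrArg hK.ringEquiv (by decide)
      rw [e] at h17mem
      rcases hP.mem_or_mem h17mem with h | h
      · exact n1 (eq_of_mem_of_mem_of_prime p₁ hπ₁ h)
      · exact n2 (eq_of_mem_of_mem_of_prime p₂ hπ₂ h)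
    · intro h2mem
      have e : (((2 : ℤ) : ℤ) : 𝓞 K) = hK.ringEquiv ⟨0, 1⟩ * hK.ringEquiv ⟨0, -1⟩ := by
        rw [← map_mul, ← hK.ringEquiv_intCast]; exact congrArg hK.ringEquiv (by decide)
      rw [e] at h2mem
      rcases hP.mem_or_mem h2mem with h | h
      · exact n0 (eq_of_mem_of_mem_of_prime p₀ hπ₀ h)
      · have h' : hK.ringEquiv ⟨0, 1⟩ ∈ v.asIdeal := by
          have e' : hK.ringEquiv ⟨0, 1⟩ = -hK.ringEquiv ⟨0, -1⟩ := by
            rw [← map_neg]; exact congrArg hK.ringEquiv (by decide)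
          rw [e']; exact v.asIdeal.neg_mem h
        exact n0 (eq_of_mem_of_mem_of_prime p₀ hπ₀ h')
  obtain ⟨hn0, hn1, hn2, hnb⟩ := nonsingular_points hK
  have hxy : ∀ i : Fin 3, ¬ (![(0 : K), 3910, (-153/4 : K)] i = 0 ∧ ![(68 : K), 274550, ((-2023 : K) + 1156 * θ) / 8] i = 0) := by
    intro i
    fin_cases i
    · simp only [Fin.zero_eta, Matrix.cons_val_zero]; norm_num
    · simp only [Fin.mk_one, Matrix.cons_val_one, Matrix.cons_val_zero]; norm_num
    · simp only [Fin.reduceFinMk, Matrix.cons_val]; norm_num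
  have hf : ∀ i : Fin 3, ((![(0 : K), 3910, (-153/4 : K)] i) * (![(68 : K), 274550, ((-2023 : K) + 1156 * θ) / 8] i) -
            ((2 : ℤ) : K) * (![(0 : K), 3910, (-153/4 : K)] i) ^ 2 +
            ((2 : ℤ) : K) ^ 2 * (![(68 : K), 274550, ((-2023 : K) + 1156 * θ) / 8] i)) =
      (![((hK.ringEquiv ⟨272, 0⟩ : 𝓞 K) : K), ((hK.ringEquiv ⟨1044012500, 0⟩ : 𝓞 K) : K), ((hK.ringEquiv ⟨183515, -158372⟩ : 𝓞 K) : K) / 32] i) := by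
    intro i
    fin_cases i
    · simp only [Fin.zero_eta, Matrix.cons_val_zero, hK.coe_ringEquiv]
      push_cast; ring
    · simp only [Fin.mk_one, Matrix.cons_val_one, Matrix.cons_val_zero, hK.coe_ringEquiv]
      push_cast; ring
    · simp only [Fin.reduceFinMk, Matrix.cons_val, hK.coe_ringEquiv]
      push_cast; ring
  have hfb : ((34 : K) * 578 - ((2 : ℤ) : K) * 34 ^ 2 + ((2 : ℤ) : K) ^ 2 * 578) =
      (((hK.ringEquiv ⟨19652, 0⟩ : 𝓞 K) : 𝓞 K) : K) := by
    rw [hK.coe_ringEquiv]; push_cast; ring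
  have hmat : Matrix.of (fun i j : Fin 3 ↦
      ((WithZero.log ((![v₀, v₁, v₂] j).valuation K
          ((![(0 : K), 3910, (-153/4 : K)] i) * (![(68 : K), 274550, ((-2023 : K) + 1156 * θ) / 8] i) -
            ((2 : ℤ) : K) * (![(0 : K), 3910, (-153/4 : K)] i) ^ 2 +
            ((2 : ℤ) : K) ^ 2 * (![(68 : K), 274550, ((-2023 : K) + 1156 * θ) / 8] i))) -
        WithZero.log ((![v₀, v₁, v₂] j).valuation K
          ((34 : K) * 578 - ((2 : ℤ) : K) * 34 ^ 2 + ((2 : ℤ) : K) ^ 2 * 578)) : ℤ) : ZMod 5)) =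
      !![1, 2, 2; 0, 4, 4; 4, 1, 0] := by
    ext i j
    simp only [Matrix.of_apply]
    rw [hf i, hfb, log_valuation_points hK hv₀ hv₁ hv₂ i j, log_valuation_base hK hv₀ hv₁ hv₂ j]
    fin_cases i <;> fin_cases j <;> decide
  have hinv : (!![1, 2, 0; 1, 2, 1; 4, 2, 4] : Matrix (Fin 3) (Fin 3) (ZMod 5)) *
      !![1, 2, 2; 0, 4, 4; 4, 1, 0] = 1 := by decide
  have hM : ∀ e : Fin 3 → ZMod 5, ∃ c : Fin 3 → ZMod 5, Matrix.vecMul c (Matrix.of (fun i j : Fin 3 ↦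
      ((WithZero.log ((![v₀, v₁, v₂] j).valuation K
          ((![(0 : K), 3910, (-153/4 : K)] i) * (![(68 : K), 274550, ((-2023 : K) + 1156 * θ) / 8] i) -
            ((2 : ℤ) : K) * (![(0 : K), 3910, (-153/4 : K)] i) ^ 2 +
            ((2 : ℤ) : K) ^ 2 * (![(68 : K), 274550, ((-2023 : K) + 1156 * θ) / 8] i))) -
        WithZero.log ((![v₀, v₁, v₂] j).valuation K
          ((34 : K) * 578 - ((2 : ℤ) : K) * 34 ^ 2 + ((2 : ℤ) : K) ^ 2 * 578)) : ℤ) : ZMod 5))) = e := by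
    intro e
    refine ⟨Matrix.vecMul e !![1, 2, 0; 1, 2, 1; 4, 2, 4], ?_⟩
    rw [hmat, Matrix.vecMul_vecMul, hinv, Matrix.vecMul_one]
  have h25 := KubertTateGaussianTwist.twentyfive_zsmul_toGeomPoints_cast_ne_zero (K := K) 17 2 KubertTate172Descent.nonsingular_P₁
    (by norm_num) (by norm_num) 3 (by norm_num) (by norm_num) KubertTate172Descent.not_tor_dvd_Δ
  refine ⟨?_, ?_, ?_⟩
  · exact KubertTateMuDescentNF.shaCorank_five_eq_zero_of_matrix_sqrtNegTwo 17 2 _ (fun σ ↦ smul_toGeomPoints _ σ _) h25 hK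
      KubertTate172Descent.not_five_dvd_Δ sqrtNegTwo_tame ![v₀, v₁, v₂] hpl hS
      ![(0 : K), 3910, (-153/4 : K)]
      ![(68 : K), 274550, ((-2023 : K) + 1156 * θ) / 8]
      (fun i ↦ by fin_cases i <;> assumption) hxy
      34 578 hnb (by norm_num) hM
  · exact KubertTateMuDescentNF.sha_torsionBy_five_eq_bot_of_matrix_sqrtNegTwo 17 2 _ (fun σ ↦ smul_toGeomPoints _ σ _) h25 hK
      KubertTate172Descent.not_five_dvd_Δ sqrtNegTwo_tame ![v₀, v₁, v₂] hpl hS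
      ![(0 : K), 3910, (-153/4 : K)]
      ![(68 : K), 274550, ((-2023 : K) + 1156 * θ) / 8]
      (fun i ↦ by fin_cases i <;> assumption) hxy
      34 578 hnb (by norm_num) hM
  · exact KubertTateMuDescentNF.mordellWeilRank_succ_eq_of_matrix_sqrtNegTwo 17 2 _ (fun σ ↦ smul_toGeomPoints _ σ _) h25 hK
      KubertTate172Descent.not_five_dvd_Δ sqrtNegTwo_tame ![v₀, v₁, v₂] hpl hS
      ![(0 : K), 3910, (-153/4 : K)]
      ![(68 : K), 274550, ((-2023 : K) + 1156 * θ) / 8]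
      (fun i ↦ by fin_cases i <;> assumption) hxy
      34 578 hnb (by norm_num) hM

/-! ## §4 The theorems -/

/-- **`t₅(E_{17/2} ⊗ ℚ(√−2)) = 0`, UNCONDITIONALLY.** [cite: SilvermanAEC2009, Thm. X.4.2(a)] [cite: Fisher2001FiveSevenDescent, §2] -/
theorem shaCorank_five_eq_zero (hK : SqrtNegTwo.FieldData θ) :
    haveI := isElliptic (K := K)
    (kubertTateFive ((17 : ℤ) : K) ((2 : ℤ) : K)).shaCorank 5 = 0 := (descent hK).1

/-- **`Ш(E_{17/2}/ℚ(√−2))[5] = 0`, unconditionally.** [cite: SilvermanAEC2009, Thm. X.4.2(a)] -/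
theorem sha_torsionBy_five_eq_bot (hK : SqrtNegTwo.FieldData θ) :
    haveI := isElliptic (K := K)
    (kubertTateFive ((17 : ℤ) : K) ((2 : ℤ) : K)).sha[((5 : ℕ) : ℤ)] = ⊥ := (descent hK).2.1

/-- **`rank E_{17/2}(ℚ(√−2)) = 2`, unconditionally.** [cite: SilvermanAEC2009, Thm. X.4.2 and Thm. X.1.1] -/
theorem mordellWeilRank_eq_two (hK : SqrtNegTwo.FieldData θ) :
    haveI := isElliptic (K := K)
    (kubertTateFive ((17 : ℤ) : K) ((2 : ℤ) : K)).mordellWeilRank = 2 := by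
  have h := (descent hK).2.2
  omega

end KubertTate172SqrtNegTwoDescent

end Literature.NumberTheory.EllipticCurves

end
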